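import Mathlib
import HarnessLib
import Summits.NavierStokesRegularity.NavierStokesRegularity.Theorems.PoloidalWindowDoorLrcModEntireJetCertDefs

/-!
# Route `PoloidalWindowDoor`, item `LrcModEntire` (stmt-NavierStokesRegularity-20428) — JET LETTERS: iterated directional derivatives
# of analytic functions as the coordinates of a jet map (instantiation toolkit for the certificate checker)

Cell ns-regularity-ideate, seat ns-poloidal-K2-p3 gen 7 (lead of item 20428; `--supports stmt-NavierStokesRegularity-20428`; definitions reviewed).
Third file of the kernel-side certificate machinery (`…JetCertDefs`: total derivative + interpreter; `…JetCertMasked`: truncated jets).  To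
run a certificate against the registered local statement `stub_localTHEmpty` one needs a JET MAP `g : E → ℝⁿ` built from the analytic
data `(u, μ, A)` whose coordinates have polynomial derivative tables.  The natural coordinates are ITERATED DIRECTIONAL DERIVATIVES along
words of constant directions:

* `jetLetter u w` — for `u : E → ℝ` and a word `w = [v₁, …, v_k]` of vectors, the function `x ↦ ∂_{v₁} ∂_{v₂} ⋯ ∂_{v_k} u (x)`
  (outermost derivative first), defined by iterating `fderiv`; BY DEFINITION `D(jetLetter u w)(x) v = jetLetter u (v :: w) x`
  (`fderiv_jetLetter`) — the derivative table of a letter is the next letter, with no side condition;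
* `analyticOnNhd_jetLetter` — on a set where `u` is analytic every letter is analytic (hence differentiable: `differentiableAt_jetLetter`);
* `jetLetter_swap` — adjacent directions commute at points of an OPEN set of analyticity (symmetry of second derivatives), and
  `jetLetter_congr_prefix` / `jetLetter_swap_inside` — so do directions anywhere inside the word; these are the COMMUTATION LAWS a
  certificate may use as hypotheses (or the justification for indexing letters by sorted multi-indices);
* `mkJet F` — the jet map `x ↦ (F₀ x, …, F_{n−1} x) ∈ ℝⁿ` of a family of scalar letters, with `mkJet_apply`, `differentiableAt_mkJet`,
  `fderiv_mkJet_coord` (the coordinate derivatives are those of the letters) — exactly the data `hg`, `hS` of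
  `…JetCertDefs.cert_contradiction` / `…JetCertMasked.cert_contradictionM`;
* `fderiv_comp_timeHeight` — letters that are functions of `(time, height)` only (`p ↦ G(p.1, p.2 2)`, the slope and pressure data
  of (TH)): their derivative along `(τ, e)` is `DG(p.1, p.2 2)(τ, e₂)` — zero along horizontal directions.

WHAT THIS IS NOT: not a claim about Navier–Stokes and not a certificate — instantiation plumbing (bears_on LADDER-NS N0, item 20428).
References: iterated Fréchet derivatives and their symmetry (Dieudonné (8.12); Mathlib `IsSymmSndFDerivAt`). [folklore]
-/

noncomputable section

-- the summit and its single sub-problem share the name (CONVENTIONS §1), as in every Theorems file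
set_option linter.dupNamespace false

namespace Summit.NavierStokesRegularity.NavierStokesRegularity.Theorems.PoloidalWindowDoorLrcModEntireJetLetters

open _root_.Topology _root_.Filter Set

variable {E : Type*} [NormedAddCommGroup E] [NormedSpace ℝ E]

/-! ### Jet letters -/

/-- The iterated directional derivative of `u` along the word `w` (outermost first):
`jetLetter u [] = u`, `jetLetter u (v :: w) x = D(jetLetter u w)(x) v`. [folklore] -/
def jetLetter (u : E → ℝ) : List E → E → ℝ
  | [] => u
  | v :: w => fun x => fderiv ℝ (jetLetter u w) x v

/-- [folklore] -/
@[simp] theorem jetLetter_nil (u : E → ℝ) : jetLetter u [] = u := rfl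

/-- [folklore] -/
theorem jetLetter_cons (u : E → ℝ) (v : E) (w : List E) :
    jetLetter u (v :: w) = fun x => fderiv ℝ (jetLetter u w) x v := rfl

/-- **The derivative table of a letter is the next letter** (by definition, no hypothesis). [folklore] -/
theorem fderiv_jetLetter (u : E → ℝ) (w : List E) (x v : E) :
    fderiv ℝ (jetLetter u w) x v = jetLetter u (v :: w) x := rfl

/-- Letters of an analytic function are analytic (on any set of analyticity). [folklore] -/
theorem analyticOnNhd_jetLetter [CompleteSpace E] {u : E → ℝ} {U : Set E} (hu : AnalyticOnNhd ℝ u U) :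
    ∀ w : List E, AnalyticOnNhd ℝ (jetLetter u w) U := by
  intro w
  induction w with
  | nil => simpa using hu
  | cons v w ih =>
    intro x hx
    rw [jetLetter_cons]
    exact ((ContinuousLinearMap.apply ℝ ℝ v).analyticAt _).comp ((ih x hx).fderiv)

/-- Letters of an analytic function are differentiable at the points of the set. [folklore] -/
theorem differentiableAt_jetLetter [CompleteSpace E] {u : E → ℝ} {U : Set E} (hu : AnalyticOnNhd ℝ u U) (w : List E)
    {x : E} (hx : x ∈ U) : DifferentiableAt ℝ (jetLetter u w) x :=
  (analyticOnNhd_jetLetter hu w x hx).differentiableAt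

/-- **Adjacent directions commute** at points of a set of analyticity (symmetry of the second derivative of the analytic
function `jetLetter u w`). [folklore] -/
theorem jetLetter_swap [CompleteSpace E] {u : E → ℝ} {U : Set E} (hu : AnalyticOnNhd ℝ u U)
    (v v' : E) (w : List E) {x : E} (hx : x ∈ U) :
    jetLetter u (v :: v' :: w) x = jetLetter u (v' :: v :: w) x := by
  set f := jetLetter u w with hf
  have hfa : AnalyticAt ℝ f x := analyticOnNhd_jetLetter hu w x hx
  have hf2 : ContDiffAt ℝ 2 f x := hfa.contDiffAt
  have hd : DifferentiableAt ℝ (fderiv ℝ f) x := (hfa.fderiv).differentiableAt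
  have hsymm : IsSymmSndFDerivAt ℝ f x := hf2.isSymmSndFDerivAt (by simp)
  have key : ∀ a b : E, jetLetter u (a :: b :: w) x = fderiv ℝ (fderiv ℝ f) x a b := by
    intro a b
    rw [jetLetter_cons]
    show fderiv ℝ (jetLetter u (b :: w)) x a = _
    rw [jetLetter_cons, ← hf, fderiv_clm_apply hd (differentiableAt_const b)]
    simp
  rw [key, key, hsymm v v']

/-- Words with equal letters on an open set keep equal letters after prefixing (derivatives of functions agreeing near a point agree).
[folklore] -/
theorem jetLetter_congr_prefix {u : E → ℝ} {U : Set E} (hU : IsOpen U) {w₁ w₂ : List E}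
    (h : ∀ x ∈ U, jetLetter u w₁ x = jetLetter u w₂ x) (p : List E) :
    ∀ x ∈ U, jetLetter u (p ++ w₁) x = jetLetter u (p ++ w₂) x := by
  induction p with
  | nil => simpa using h
  | cons v p ih =>
    intro x hx
    rw [List.cons_append, List.cons_append, jetLetter_cons, jetLetter_cons]
    have hev : jetLetter u (p ++ w₁) =ᶠ[𝓝 x] jetLetter u (p ++ w₂) := by
      filter_upwards [hU.mem_nhds hx] with y hy using ih y hy
    show fderiv ℝ (jetLetter u (p ++ w₁)) x v = fderiv ℝ (jetLetter u (p ++ w₂)) x v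
    rw [hev.fderiv_eq]

/-- **Directions commute anywhere inside a word** (on an open set of analyticity). [folklore] -/
theorem jetLetter_swap_inside [CompleteSpace E] {u : E → ℝ} {U : Set E} (hU : IsOpen U) (hu : AnalyticOnNhd ℝ u U)
    (p : List E) (v v' : E) (w : List E) {x : E} (hx : x ∈ U) :
    jetLetter u (p ++ v :: v' :: w) x = jetLetter u (p ++ v' :: v :: w) x :=
  jetLetter_congr_prefix hU (fun _ hy => jetLetter_swap hu v v' w hy) p x hx

/-! ### The jet map of a family of letters -/

/-- The jet map `x ↦ (F₀ x, …, F_{n−1} x) ∈ ℝⁿ` of a family of scalar functions. [folklore] -/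
def mkJet {X : Type*} {n : ℕ} (F : Fin n → X → ℝ) (x : X) : EuclideanSpace ℝ (Fin n) :=
  WithLp.toLp 2 fun i => F i x

/-- [folklore] -/
@[simp] theorem mkJet_apply {X : Type*} {n : ℕ} (F : Fin n → X → ℝ) (x : X) (i : Fin n) : mkJet F x i = F i x := rfl

/-- The jet map is differentiable where every letter is. [folklore] -/
theorem differentiableAt_mkJet {n : ℕ} {F : Fin n → E → ℝ} {x : E} (hF : ∀ i, DifferentiableAt ℝ (F i) x) :
    DifferentiableAt ℝ (mkJet F) x := by
  rw [differentiableAt_piLp]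
  intro i
  exact hF i

/-- The coordinate derivatives of the jet map are the derivatives of the letters. [folklore] -/
theorem fderiv_mkJet_coord {n : ℕ} (F : Fin n → E → ℝ) (x v : E) (i : Fin n) :
    fderiv ℝ (fun y => mkJet F y i) x v = fderiv ℝ (F i) x v := rfl

/-! ### Letters depending on time and height only -/

/-- **Derivative of a function of `(time, height)`** read on space–time `ℝ × ℝ³`: for `G : ℝ × ℝ → ℝ` differentiable at
`(p.1, p.2 2)`, the function `q ↦ G(q.1, q.2 2)` has derivative `DG(p.1, p.2 2)(τ, e 2)` along `(τ, e)` — in particular `0`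
along horizontal directions `(0, e)` with `e 2 = 0` whenever `DG(·)(0,0) = 0` is used, and the height/time partials otherwise. [folklore] -/
theorem fderiv_comp_timeHeight {G : ℝ × ℝ → ℝ} {p : ℝ × EuclideanSpace ℝ (Fin 3)}
    (hG : DifferentiableAt ℝ G (p.1, p.2 2)) (τ : ℝ) (e : EuclideanSpace ℝ (Fin 3)) :
    fderiv ℝ (fun q : ℝ × EuclideanSpace ℝ (Fin 3) => G (q.1, q.2 2)) p (τ, e) = fderiv ℝ G (p.1, p.2 2) (τ, e 2) := by
  -- the shadow map is a continuous linear map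
  set L : ℝ × EuclideanSpace ℝ (Fin 3) →L[ℝ] ℝ × ℝ :=
    (ContinuousLinearMap.fst ℝ ℝ (EuclideanSpace ℝ (Fin 3))).prod
      ((EuclideanSpace.proj (𝕜 := ℝ) (2 : Fin 3)).comp (ContinuousLinearMap.snd ℝ ℝ (EuclideanSpace ℝ (Fin 3)))) with hL
  have hLap : ∀ q : ℝ × EuclideanSpace ℝ (Fin 3), L q = (q.1, q.2 2) := fun q => rfl
  have hcomp : (fun q : ℝ × EuclideanSpace ℝ (Fin 3) => G (q.1, q.2 2)) = G ∘ L := by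
    funext q; simp [hLap]
  rw [hcomp, fderiv_comp p (by rw [hLap]; exact hG) L.differentiableAt, L.fderiv]
  simp [hLap]

/-- The shadow point of a differentiable-analytic datum: differentiability of `q ↦ G(q.1, q.2 2)`. [folklore] -/
theorem differentiableAt_comp_timeHeight {G : ℝ × ℝ → ℝ} {p : ℝ × EuclideanSpace ℝ (Fin 3)}
    (hG : DifferentiableAt ℝ G (p.1, p.2 2)) :
    DifferentiableAt ℝ (fun q : ℝ × EuclideanSpace ℝ (Fin 3) => G (q.1, q.2 2)) p := by
  have h2 : DifferentiableAt ℝ (fun q : ℝ × EuclideanSpace ℝ (Fin 3) => ((q.1, q.2 2) : ℝ × ℝ)) p :=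
    differentiableAt_fst.prodMk ((EuclideanSpace.proj (𝕜 := ℝ) (2 : Fin 3)).differentiableAt.comp p differentiableAt_snd)
  exact hG.comp p h2

/-! ### Permutations of directions (appended, ns-poloidal-K2-p3 g7) -/

/-- **All orderings of the directions give the same letter** on an open set of analyticity: `jetLetter u w = jetLetter u w'` on `U`
whenever `w` is a permutation of `w'` (so letters may be indexed by multi-indices, and the derivative table `∂_v X_α = X_{α + v}` holds
on `U` for any fixed ordering convention). [folklore] -/
theorem jetLetter_perm [CompleteSpace E] {u : E → ℝ} {U : Set E} (hU : IsOpen U) (hu : AnalyticOnNhd ℝ u U)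
    {w w' : List E} (h : w.Perm w') : ∀ x ∈ U, jetLetter u w x = jetLetter u w' x := by
  induction h with
  | nil => intro x _; rfl
  | cons v _ ih =>
    intro x hx
    simpa using jetLetter_congr_prefix hU ih [v] x hx
  | swap a b w => intro x hx; exact jetLetter_swap hu b a w hx
  | trans _ _ ih₁ ih₂ => intro x hx; exact (ih₁ x hx).trans (ih₂ x hx)

/-- The derivative table of a multi-index letter under ANY ordering convention: if `w'` is a permutation of `v :: w`, then on `U`
`D(jetLetter u w)(x) v = jetLetter u w' x`. [folklore] -/
theorem fderiv_jetLetter_of_perm [CompleteSpace E] {u : E → ℝ} {U : Set E} (hU : IsOpen U) (hu : AnalyticOnNhd ℝ u U)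
    {w w' : List E} {v : E} (h : (v :: w).Perm w') {x : E} (hx : x ∈ U) :
    fderiv ℝ (jetLetter u w) x v = jetLetter u w' x := by
  rw [fderiv_jetLetter]
  exact jetLetter_perm hU hu h x hx

end Summit.NavierStokesRegularity.NavierStokesRegularity.Theorems.PoloidalWindowDoorLrcModEntireJetLetters

end
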